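import Mathlib.Analysis.Complex.CauchyIntegral
import Mathlib.Analysis.Matrix.Normed
import Mathlib.Topology.UniformSpace.Matrix
import Mathlib.LinearAlgebra.Matrix.NonsingularInverse
import Mathlib.Analysis.Calculus.FDeriv.Mul
import Mathlib.MeasureTheory.Integral.Prod
import Mathlib.Topology.MetricSpace.Thickening
import Mathlib.Topology.Algebra.Module.FiniteDimension
import HarnessLib

/-!
# Spectral projections of a regular linear matrix pencil (Husemöller, *Fibre Bundles*, Ch. 11 §4)

The finite-dimensional analysis behind the Atiyah–Bott linearisation step of complex Bott
periodicity, for a *fixed* pencil `w ↦ w a + b` of complex `ι × ι` matrices which is **regular**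
on the unit circle (`IsRegular a b : ∀ |w| = 1, w a + b invertible`):

* `P0 a b = (2πi)⁻¹ ∮_{|w|=1} (w a + b)⁻¹ a dw` and `Pinf a b = (2πi)⁻¹ ∮ a (w a + b)⁻¹ dw`
  (Husemöller 11 (4.2)), with the resolvent identity **(R)** `inverse_sub_inverse`;
* **(α)** `(w₀ a + b) P₀ = P_∞ (w₀ a + b)` for all `w₀` (`IsRegular.pencil_mul_P0`, hence
  `a P₀ = P_∞ a`, `b P₀ = P_∞ b`);
* **(β)** the action on generalised eigenvectors (Husemöller 11 Prop. 4.5): `P₀ v = v` if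
  `(w₀ a + b) v = 0` with `|w₀| < 1`, `P₀ v = 0` if `|w₀| > 1`, `a v = 0 ⇒ P₀ v = 0`,
  `b v = 0 ⇒ P₀ v = v` (Cauchy integral formula / Cauchy–Goursat);
* **(γ)** `IsRegular.P0_mul_P0 : P₀² = P₀` (two radii inside a regular annulus
  `IsRegular.exists_annulus`, change of radius by Cauchy's theorem on an annulus, Fubini for
  iterated circle integrals `circleIntegral_swap`, and `∮ (z-w)⁻¹`), and `P_∞² = P_∞`;
* **Husemöller 11 Prop. 4.6 (pointwise)** `IsRegular.isUnit_homotopy`: the matrices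
  `p^t = (z a + t b) P₀ + (t z a + b)(1 - P₀)` are invertible for `|z| = 1`, `0 ≤ t ≤ 1`;
* `continuous_P0_family`: `P₀` depends continuously on a continuous regular family (parametric
  interval integrals), used to define the bundles `ζ₊ = im P₀` over a compact base.

Everything is proved; no named facts.

## References

* D. Husemöller, *Fibre Bundles*, 3rd ed. (1994) [HusemollerFibreBundles1994]: Ch. 11 §4,
  (4.1)–(4.6) and the identity (R).
-/

noncomputable section

open Complex MeasureTheory Metric Set Filter intervalIntegral
open scoped Real Topology Matrix

namespace Literature.AlgebraicTopology.KTheory.Pencil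

attribute [local instance] Matrix.linftyOpNormedRing Matrix.linftyOpNormedAlgebra

variable {ι : Type} [Fintype ι] [DecidableEq ι]

/-- Completeness of `M_ι(ℂ)` for the operator-norm uniformity (which is the product uniformity). [folklore] -/
instance completeSpace_matrix : @CompleteSpace (Matrix ι ι ℂ) PseudoMetricSpace.toUniformSpace :=
  (inferInstance : @CompleteSpace (Matrix ι ι ℂ) (Matrix.instUniformSpace _ _ _))

/-- The linear pencil `w ↦ w a + b`. [cite: HusemollerFibreBundles1994, Ch. 11 Notation 4.2] -/
def pencil (a b : Matrix ι ι ℂ) (w : ℂ) : Matrix ι ι ℂ := w • a + b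

/-- The integrand `(w a + b)⁻¹ a` of `P₀`. [cite: HusemollerFibreBundles1994, Ch. 11 Notation 4.2] -/
def res (a b : Matrix ι ι ℂ) (w : ℂ) : Matrix ι ι ℂ := Ring.inverse (pencil a b w) * a

/-- The integrand `a (w a + b)⁻¹` of `P_∞`. [cite: HusemollerFibreBundles1994, Ch. 11 Notation 4.2] -/
def resInf (a b : Matrix ι ι ℂ) (w : ℂ) : Matrix ι ι ℂ := a * Ring.inverse (pencil a b w)

/-- **`P₀ = (2πi)⁻¹ ∮_{|w|=1} (a w + b)⁻¹ a dw`.** [cite: HusemollerFibreBundles1994, Ch. 11 Notation 4.2] -/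
def P0 (a b : Matrix ι ι ℂ) : Matrix ι ι ℂ := (2 * π * I)⁻¹ • ∮ w in C(0, 1), res a b w

/-- **`P_∞ = (2πi)⁻¹ ∮_{|w|=1} a (a w + b)⁻¹ dw`.** [cite: HusemollerFibreBundles1994, Ch. 11 Notation 4.2] -/
def Pinf (a b : Matrix ι ι ℂ) : Matrix ι ι ℂ := (2 * π * I)⁻¹ • ∮ w in C(0, 1), resInf a b w

/-- Regularity of the pencil on the unit circle. [cite: HusemollerFibreBundles1994, Ch. 11 Notation 4.2] -/
def IsRegular (a b : Matrix ι ι ℂ) : Prop := ∀ w : ℂ, ‖w‖ = 1 → IsUnit (pencil a b w)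

variable (a b : Matrix ι ι ℂ)

omit [Fintype ι] [DecidableEq ι] in
/-- Auxiliary statement for spectral projections of a regular pencil. [folklore] -/
theorem continuous_pencil : Continuous (pencil a b) := by
  unfold pencil; fun_prop

/-- Auxiliary statement for spectral projections of a regular pencil. [folklore] -/
theorem isOpen_setOf_isUnit_pencil : IsOpen {w : ℂ | IsUnit (pencil a b w)} :=
  Units.isOpen.preimage (continuous_pencil a b)

/-- Auxiliary statement for spectral projections of a regular pencil. [folklore] -/
theorem continuousAt_res {w : ℂ} (hw : IsUnit (pencil a b w)) : ContinuousAt (res a b) w := by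
  obtain ⟨u, hu⟩ := hw
  have h1 : ContinuousAt Ring.inverse (pencil a b w) := hu ▸ NormedRing.inverse_continuousAt u
  exact (h1.comp (continuous_pencil a b).continuousAt).mul continuousAt_const

/-- Auxiliary statement for spectral projections of a regular pencil. [folklore] -/
theorem continuousAt_resInf {w : ℂ} (hw : IsUnit (pencil a b w)) : ContinuousAt (resInf a b) w := by
  obtain ⟨u, hu⟩ := hw
  have h1 : ContinuousAt Ring.inverse (pencil a b w) := hu ▸ NormedRing.inverse_continuousAt u
  exact continuousAt_const.mul (h1.comp (continuous_pencil a b).continuousAt)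

/-- Auxiliary statement for spectral projections of a regular pencil. [folklore] -/
theorem continuousOn_res : ContinuousOn (res a b) {w | IsUnit (pencil a b w)} :=
  fun _ hw ↦ (continuousAt_res a b hw).continuousWithinAt

/-- Auxiliary statement for spectral projections of a regular pencil. [folklore] -/
theorem continuousOn_resInf : ContinuousOn (resInf a b) {w | IsUnit (pencil a b w)} :=
  fun _ hw ↦ (continuousAt_resInf a b hw).continuousWithinAt

/-- Auxiliary statement for spectral projections of a regular pencil. [folklore] -/
theorem differentiable_pencil : Differentiable ℂ (pencil a b) := by
  unfold pencil; fun_prop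

/-- Auxiliary statement for spectral projections of a regular pencil. [folklore] -/
theorem differentiableAt_res {w : ℂ} (hw : IsUnit (pencil a b w)) : DifferentiableAt ℂ (res a b) w :=
  ((differentiableAt_inverse hw).comp w (differentiable_pencil a b w)).mul_const a

/-- Auxiliary statement for spectral projections of a regular pencil. [folklore] -/
theorem differentiableAt_resInf {w : ℂ} (hw : IsUnit (pencil a b w)) : DifferentiableAt ℂ (resInf a b) w :=
  (differentiableAt_const a).mul ((differentiableAt_inverse hw).comp w (differentiable_pencil a b w))

/-- The resolvent identity **(R)**: `(w a + b)⁻¹ - (z a + b)⁻¹ = (z - w) (w a + b)⁻¹ a (z a + b)⁻¹`.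
[cite: HusemollerFibreBundles1994, Ch. 11 §4 (R)] -/
theorem inverse_sub_inverse {w z : ℂ} (hw : IsUnit (pencil a b w)) (hz : IsUnit (pencil a b z)) :
    Ring.inverse (pencil a b w) - Ring.inverse (pencil a b z) = (z - w) • (res a b w * Ring.inverse (pencil a b z)) := by
  obtain ⟨W, hW⟩ := hw
  obtain ⟨Z, hZ⟩ := hz
  rw [res, ← hW, ← hZ, Ring.inverse_unit, Ring.inverse_unit]
  have key : (Z : Matrix ι ι ℂ) - W = (z - w) • a := by
    rw [hW, hZ, pencil, pencil, sub_smul]; abel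
  calc (↑W⁻¹ : Matrix ι ι ℂ) - ↑Z⁻¹ = ↑W⁻¹ * ((Z : Matrix ι ι ℂ) - W) * ↑Z⁻¹ := by
        rw [Matrix.mul_sub, Matrix.sub_mul, Units.inv_mul, Matrix.one_mul, Matrix.mul_assoc, Units.mul_inv, Matrix.mul_one]
    _ = (z - w) • (↑W⁻¹ * a * ↑Z⁻¹) := by
        rw [key, Matrix.mul_smul, Matrix.smul_mul, Matrix.mul_assoc]

/-! ### Linear operations through the circle integral -/

section CLM

variable {E F : Type*} [NormedAddCommGroup E] [NormedSpace ℂ E] [CompleteSpace E] [NormedAddCommGroup F] [NormedSpace ℂ F]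
  [CompleteSpace F]

omit [Fintype ι] [DecidableEq ι] in
/-- Continuous linear maps commute with circle integrals. [folklore] -/
theorem clm_circleIntegral (L : E →L[ℂ] F) {f : ℂ → E} {c : ℂ} {R : ℝ} (hf : CircleIntegrable f c R) :
    (∮ z in C(c, R), L (f z)) = L (∮ z in C(c, R), f z) := by
  simp only [circleIntegral]
  rw [← L.intervalIntegral_comp_comm ((circleIntegrable_iff R).1 hf)]
  simp only [map_smul]

end CLM

/-- Left multiplication by a fixed matrix, as a continuous linear map. [folklore] -/
def mulLeftCLM (M : Matrix ι ι ℂ) : Matrix ι ι ℂ →L[ℂ] Matrix ι ι ℂ :=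
  LinearMap.toContinuousLinearMap (LinearMap.mulLeft ℂ M)

/-- Right multiplication by a fixed matrix, as a continuous linear map. [folklore] -/
def mulRightCLM (M : Matrix ι ι ℂ) : Matrix ι ι ℂ →L[ℂ] Matrix ι ι ℂ :=
  LinearMap.toContinuousLinearMap (LinearMap.mulRight ℂ M)

/-- Application to a fixed vector, as a continuous linear map. [folklore] -/
def mulVecCLM (v : ι → ℂ) : Matrix ι ι ℂ →L[ℂ] (ι → ℂ) :=
  LinearMap.toContinuousLinearMap
    { toFun := fun M ↦ M *ᵥ v
      map_add' := fun M N ↦ Matrix.add_mulVec M N v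
      map_smul' := fun c M ↦ Matrix.smul_mulVec c M v }

/-- Auxiliary statement for spectral projections of a regular pencil. [folklore] -/
@[simp] theorem mulLeftCLM_apply (M N : Matrix ι ι ℂ) : mulLeftCLM M N = M * N := rfl
/-- Unfolding lemma. [folklore] -/
@[simp] theorem mulRightCLM_apply (M N : Matrix ι ι ℂ) : mulRightCLM M N = N * M := rfl
omit [DecidableEq ι] in
/-- Auxiliary statement for spectral projections of a regular pencil. [folklore] -/
@[simp] theorem mulVecCLM_apply (v : ι → ℂ) (M : Matrix ι ι ℂ) : mulVecCLM v M = M *ᵥ v := rfl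

/-- Auxiliary statement for spectral projections of a regular pencil. [folklore] -/
theorem circleIntegral_const_mul (M : Matrix ι ι ℂ) {f : ℂ → Matrix ι ι ℂ} {c : ℂ} {R : ℝ} (hf : CircleIntegrable f c R) :
    (∮ z in C(c, R), M * f z) = M * ∮ z in C(c, R), f z :=
  clm_circleIntegral (mulLeftCLM M) hf

/-- Auxiliary statement for spectral projections of a regular pencil. [folklore] -/
theorem circleIntegral_mul_const (M : Matrix ι ι ℂ) {f : ℂ → Matrix ι ι ℂ} {c : ℂ} {R : ℝ} (hf : CircleIntegrable f c R) :
    (∮ z in C(c, R), f z * M) = (∮ z in C(c, R), f z) * M :=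
  clm_circleIntegral (mulRightCLM M) hf

/-- Auxiliary statement for spectral projections of a regular pencil. [folklore] -/
theorem circleIntegral_mulVec (v : ι → ℂ) {f : ℂ → Matrix ι ι ℂ} {c : ℂ} {R : ℝ} (hf : CircleIntegrable f c R) :
    (∮ z in C(c, R), f z *ᵥ v) = (∮ z in C(c, R), f z) *ᵥ v :=
  clm_circleIntegral (mulVecCLM v) hf

/-! ### Regular pencils: integrability on the unit circle -/

variable {a b}

/-- Auxiliary statement for spectral projections of a regular pencil. [folklore] -/
theorem IsRegular.circleIntegrable_res (h : IsRegular a b) : CircleIntegrable (res a b) 0 1 :=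
  ContinuousOn.circleIntegrable zero_le_one fun w hw ↦
    (continuousAt_res a b (h w (by simpa using hw))).continuousWithinAt

/-- Auxiliary statement for spectral projections of a regular pencil. [folklore] -/
theorem IsRegular.circleIntegrable_resInf (h : IsRegular a b) : CircleIntegrable (resInf a b) 0 1 :=
  ContinuousOn.circleIntegrable zero_le_one fun w hw ↦
    (continuousAt_resInf a b (h w (by simpa using hw))).continuousWithinAt

/-! ### (α) `(w₀ a + b) P₀ = P_∞ (w₀ a + b)` -/

variable (a b) in
/-- Pointwise identity behind (α): `(w₀a + b)(wa+b)⁻¹a = a(wa+b)⁻¹(w₀a+b)`. [cite: HusemollerFibreBundles1994, Ch. 11 Prop. 4.2] -/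
theorem pencil_mul_res {w₀ w : ℂ} (hw : IsUnit (pencil a b w)) : pencil a b w₀ * res a b w = resInf a b w * pencil a b w₀ := by
  obtain ⟨W, hW⟩ := hw
  have key : pencil a b w₀ = (W : Matrix ι ι ℂ) + (w₀ - w) • a := by rw [hW, pencil, pencil, sub_smul]; abel
  rw [res, resInf, key, ← hW, Ring.inverse_unit, Matrix.add_mul, Matrix.mul_add, ← Matrix.mul_assoc, Units.mul_inv, Matrix.one_mul,
    Matrix.mul_assoc a, Units.inv_mul, Matrix.mul_one, Matrix.smul_mul, Matrix.mul_smul, Matrix.mul_assoc]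

/-- **(α)** `(w₀ a + b) P₀ = P_∞ (w₀ a + b)` for every `w₀`. [cite: HusemollerFibreBundles1994, Ch. 11 Prop. 4.2] -/
theorem IsRegular.pencil_mul_P0 (h : IsRegular a b) (w₀ : ℂ) : pencil a b w₀ * P0 a b = Pinf a b * pencil a b w₀ := by
  rw [P0, Pinf, Matrix.mul_smul, Matrix.smul_mul, ← circleIntegral_const_mul _ h.circleIntegrable_res,
    ← circleIntegral_mul_const _ h.circleIntegrable_resInf]
  congr 1
  refine circleIntegral.integral_congr zero_le_one fun w hw ↦ ?_
  exact pencil_mul_res a b (h w (by simpa using hw))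

/-- `b P₀ = P_∞ b`. [cite: HusemollerFibreBundles1994, Ch. 11 Prop. 4.2] -/
theorem IsRegular.b_mul_P0 (h : IsRegular a b) : b * P0 a b = Pinf a b * b := by
  simpa [pencil] using h.pencil_mul_P0 0

/-- `a P₀ = P_∞ a`. [cite: HusemollerFibreBundles1994, Ch. 11 Prop. 4.2] -/
theorem IsRegular.a_mul_P0 (h : IsRegular a b) : a * P0 a b = Pinf a b * a := by
  have h1 := h.pencil_mul_P0 1
  rw [pencil, one_smul, Matrix.add_mul, Matrix.mul_add, h.b_mul_P0, add_left_inj] at h1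
  exact h1

/-! ### (β) the action of `P₀` on generalized eigenvectors -/

/-- `∮_{|w|=1} (w - w₀)⁻¹ dw = 0` for `|w₀| > 1` (Cauchy–Goursat). [folklore] -/
theorem circleIntegral_sub_inv_of_one_lt {w₀ : ℂ} (hw₀ : 1 < ‖w₀‖) : (∮ w in C(0, 1), (w - w₀)⁻¹) = 0 := by
  have hne : ∀ w ∈ closedBall (0 : ℂ) 1, w - w₀ ≠ 0 := by
    intro w hw h
    rw [sub_eq_zero] at h
    rw [mem_closedBall, dist_zero_right, h] at hw
    linarith
  refine circleIntegral_eq_zero_of_differentiable_on_off_countable zero_le_one countable_empty ?_ ?_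
  · exact ContinuousOn.inv₀ (continuousOn_id.sub continuousOn_const) hne
  · intro z hz
    exact ((differentiableAt_id.sub_const w₀).inv (hne z (ball_subset_closedBall hz.1)))

/-- On the unit circle, `(wa+b)⁻¹ a v = (w - w₀)⁻¹ v` when `(w₀ a + b) v = 0`. [cite: HusemollerFibreBundles1994, Ch. 11 Prop. 4.5] -/
theorem res_mulVec_of_pencil_mulVec_eq_zero {w₀ w : ℂ} {v : ι → ℂ} (hv : pencil a b w₀ *ᵥ v = 0)
    (hw : IsUnit (pencil a b w)) (hne : w ≠ w₀) : res a b w *ᵥ v = (w - w₀)⁻¹ • v := by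
  obtain ⟨W, hW⟩ := hw
  have key : (W : Matrix ι ι ℂ) *ᵥ v = (w - w₀) • (a *ᵥ v) := by
    have : (W : Matrix ι ι ℂ) = pencil a b w₀ + (w - w₀) • a := by rw [hW, pencil, pencil, sub_smul]; abel
    rw [this, Matrix.add_mulVec, hv, zero_add, Matrix.smul_mulVec]
  have hsub : w - w₀ ≠ 0 := sub_ne_zero.2 hne
  have ha : a *ᵥ v = (w - w₀)⁻¹ • ((W : Matrix ι ι ℂ) *ᵥ v) := by
    rw [key, smul_smul, inv_mul_cancel₀ hsub, one_smul]
  rw [res, ← hW, Ring.inverse_unit, ← Matrix.mulVec_mulVec, ha, Matrix.mulVec_smul, Matrix.mulVec_mulVec, Units.inv_mul,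
    Matrix.one_mulVec]

/-- Auxiliary statement for spectral projections of a regular pencil. [folklore] -/
theorem IsRegular.P0_mulVec (h : IsRegular a b) (v : ι → ℂ) :
    P0 a b *ᵥ v = (2 * π * I)⁻¹ • ∮ w in C(0, 1), res a b w *ᵥ v := by
  rw [P0, Matrix.smul_mulVec, circleIntegral_mulVec v h.circleIntegrable_res]

/-- **(β₁)** `P₀ v = v` for `v ∈ ker(w₀ a + b)`, `|w₀| < 1`. [cite: HusemollerFibreBundles1994, Ch. 11 Prop. 4.5] -/
theorem IsRegular.P0_mulVec_eq_self_of_lt (h : IsRegular a b) {w₀ : ℂ} {v : ι → ℂ} (hv : pencil a b w₀ *ᵥ v = 0)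
    (hw₀ : ‖w₀‖ < 1) : P0 a b *ᵥ v = v := by
  rw [h.P0_mulVec]
  have heq : (∮ w in C(0, 1), res a b w *ᵥ v) = ∮ w in C(0, 1), (w - w₀)⁻¹ • v := by
    refine circleIntegral.integral_congr zero_le_one fun w hw ↦ ?_
    have hw1 : ‖w‖ = 1 := by simpa using hw
    exact res_mulVec_of_pencil_mulVec_eq_zero hv (h w hw1) (by rintro rfl; exact absurd hw1 hw₀.ne)
  rw [heq, circleIntegral.integral_smul_const, circleIntegral.integral_sub_inv_of_mem_ball (by simpa using hw₀), smul_smul,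
    inv_mul_cancel₀ (by simp [Real.pi_ne_zero, I_ne_zero]), one_smul]

/-- **(β₁')** `P₀ v = 0` for `v ∈ ker(w₀ a + b)`, `|w₀| > 1`. [cite: HusemollerFibreBundles1994, Ch. 11 Prop. 4.5] -/
theorem IsRegular.P0_mulVec_eq_zero_of_gt (h : IsRegular a b) {w₀ : ℂ} {v : ι → ℂ} (hv : pencil a b w₀ *ᵥ v = 0)
    (hw₀ : 1 < ‖w₀‖) : P0 a b *ᵥ v = 0 := by
  rw [h.P0_mulVec]
  have heq : (∮ w in C(0, 1), res a b w *ᵥ v) = ∮ w in C(0, 1), (w - w₀)⁻¹ • v := by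
    refine circleIntegral.integral_congr zero_le_one fun w hw ↦ ?_
    have hw1 : ‖w‖ = 1 := by simpa using hw
    exact res_mulVec_of_pencil_mulVec_eq_zero hv (h w hw1) (by rintro rfl; exact absurd hw1 hw₀.ne')
  rw [heq, circleIntegral.integral_smul_const, circleIntegral_sub_inv_of_one_lt hw₀, zero_smul, smul_zero]

/-- **(β₂)** `a v = 0 ⇒ P₀ v = 0`. [cite: HusemollerFibreBundles1994, Ch. 11 Prop. 4.5] -/
theorem IsRegular.P0_mulVec_eq_zero_of_a (h : IsRegular a b) {v : ι → ℂ} (hv : a *ᵥ v = 0) : P0 a b *ᵥ v = 0 := by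
  rw [h.P0_mulVec]
  have heq : (∮ w in C(0, 1), res a b w *ᵥ v) = ∮ w in C(0, 1), (0 : ι → ℂ) := by
    refine circleIntegral.integral_congr zero_le_one fun w _ ↦ ?_
    simp only [res, ← Matrix.mulVec_mulVec, hv, Matrix.mulVec_zero]
  rw [heq]
  simp [circleIntegral]

/-- **(β₃)** `b v = 0 ⇒ P₀ v = v`. [cite: HusemollerFibreBundles1994, Ch. 11 Prop. 4.5] -/
theorem IsRegular.P0_mulVec_eq_self_of_b (h : IsRegular a b) {v : ι → ℂ} (hv : b *ᵥ v = 0) : P0 a b *ᵥ v = v := by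
  have hv' : pencil a b 0 *ᵥ v = 0 := by simpa [pencil] using hv
  exact h.P0_mulVec_eq_self_of_lt hv' (by simp)

/-! ### (γ) `P₀² = P₀`: two radii and Fubini -/

section Swap

variable {E : Type*} [NormedAddCommGroup E] [NormedSpace ℂ E]

omit [Fintype ι] [DecidableEq ι] in
/-- **Fubini for iterated circle integrals** of a continuous integrand. [folklore] -/
theorem circleIntegral_swap {f : ℂ → ℂ → E} {c₁ c₂ : ℂ} {R₁ R₂ : ℝ}
    (hf : ContinuousOn (Function.uncurry f) (sphere c₁ |R₁| ×ˢ sphere c₂ |R₂|)) :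
    (∮ w in C(c₁, R₁), ∮ z in C(c₂, R₂), f w z) = ∮ z in C(c₂, R₂), ∮ w in C(c₁, R₁), f w z := by
  simp only [circleIntegral, deriv_circleMap]
  have h1 : Continuous fun p : ℝ × ℝ ↦ f (circleMap c₁ R₁ p.1) (circleMap c₂ R₂ p.2) :=
    hf.comp_continuous ((continuous_circleMap c₁ R₁).prodMap (continuous_circleMap c₂ R₂))
      fun p ↦ Set.mk_mem_prod (circleMap_mem_sphere' _ _ _) (circleMap_mem_sphere' _ _ _)
  have hF : Continuous fun p : ℝ × ℝ ↦
      (circleMap 0 R₁ p.1 * I * (circleMap 0 R₂ p.2 * I)) • f (circleMap c₁ R₁ p.1) (circleMap c₂ R₂ p.2) :=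
    ((((continuous_circleMap 0 R₁).comp continuous_fst).mul continuous_const).mul
      (((continuous_circleMap 0 R₂).comp continuous_snd).mul continuous_const)).smul h1
  have hint : IntegrableOn (fun p : ℝ × ℝ ↦
      (circleMap 0 R₁ p.1 * I * (circleMap 0 R₂ p.2 * I)) • f (circleMap c₁ R₁ p.1) (circleMap c₂ R₂ p.2))
      (Set.uIoc 0 (2 * π) ×ˢ Set.uIoc 0 (2 * π)) volume := by
    refine (hF.continuousOn.integrableOn_compact
      ((isCompact_Icc (a := (0 : ℝ)) (b := 2 * π)).prod (isCompact_Icc (a := (0 : ℝ)) (b := 2 * π)))).mono_set ?_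
    rw [Set.uIoc_of_le Real.two_pi_pos.le]
    exact Set.prod_mono Ioc_subset_Icc_self Ioc_subset_Icc_self
  have hswap := MeasureTheory.intervalIntegral_intervalIntegral_swap
    (F := fun θ φ ↦ (circleMap 0 R₁ θ * I * (circleMap 0 R₂ φ * I)) • f (circleMap c₁ R₁ θ) (circleMap c₂ R₂ φ)) hint
  simp_rw [← intervalIntegral.integral_smul, smul_smul]
  simp_rw [mul_comm (circleMap 0 R₂ _ * I) (circleMap 0 R₁ _ * I)]
  exact hswap

end Swap

/-! ### A regular annulus and change of radius -/

omit [Fintype ι] [DecidableEq ι] in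
/-- Distance from `w ≠ 0` to its normalisation on the unit circle. [folklore] -/
theorem dist_normalize_eq {w : ℂ} (hw : w ≠ 0) : dist w (((‖w‖⁻¹ : ℝ) : ℂ) * w) = |‖w‖ - 1| := by
  have hn : (0 : ℝ) < ‖w‖ := norm_pos_iff.2 hw
  rw [dist_eq_norm, show w - ((‖w‖⁻¹ : ℝ) : ℂ) * w = ((1 - ‖w‖⁻¹ : ℝ) : ℂ) * w by push_cast; ring, norm_mul,
    Complex.norm_real, Real.norm_eq_abs]
  rw [show (1 - ‖w‖⁻¹) = (‖w‖ - 1) / ‖w‖ by field_simp, abs_div, abs_of_pos hn, div_mul_cancel₀ _ hn.ne']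

omit [Fintype ι] [DecidableEq ι] in
/-- Auxiliary statement for spectral projections of a regular pencil. [folklore] -/
theorem norm_normalize_eq {w : ℂ} (hw : w ≠ 0) : ‖(((‖w‖⁻¹ : ℝ) : ℂ) * w)‖ = 1 := by
  have hn : (0 : ℝ) < ‖w‖ := norm_pos_iff.2 hw
  rw [norm_mul, Complex.norm_real, Real.norm_eq_abs, abs_of_pos (inv_pos.2 hn), inv_mul_cancel₀ hn.ne']

/-- **A regular annulus**: the pencil stays invertible for `| |w| - 1 | ≤ δ`. [folklore] -/
theorem IsRegular.exists_annulus (h : IsRegular a b) :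
    ∃ δ : ℝ, 0 < δ ∧ δ < 1 ∧ ∀ w : ℂ, |‖w‖ - 1| ≤ δ → IsUnit (pencil a b w) := by
  obtain ⟨δ₀, hδ₀, hsub⟩ := (isCompact_sphere (0 : ℂ) 1).exists_cthickening_subset_open (isOpen_setOf_isUnit_pencil a b)
    (fun w hw ↦ h w (by simpa using hw))
  refine ⟨min δ₀ (1 / 2), lt_min hδ₀ (by norm_num), (min_le_right _ _).trans_lt (by norm_num), fun w hw ↦ ?_⟩
  have hw0 : w ≠ 0 := by
    intro h0; rw [h0, norm_zero, zero_sub, abs_neg, abs_one] at hw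
    linarith [min_le_right δ₀ (1 / 2 : ℝ)]
  apply hsub
  refine mem_cthickening_of_dist_le w (((‖w‖⁻¹ : ℝ) : ℂ) * w) δ₀ _ ?_ ?_
  · simpa using norm_normalize_eq hw0
  · rw [dist_normalize_eq hw0]; exact hw.trans (min_le_left _ _)

/-- `res` is continuous on a regular annulus. [folklore] -/
theorem continuousOn_res_annulus {δ : ℝ} (hδ : ∀ w : ℂ, |‖w‖ - 1| ≤ δ → IsUnit (pencil a b w)) {r₁ r₂ : ℝ}
    (h₁ : 1 - δ ≤ r₁) (h₂ : r₂ ≤ 1 + δ) : ContinuousOn (res a b) (closedBall 0 r₂ \ ball 0 r₁) := by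
  intro w hw
  refine (continuousAt_res a b (hδ w ?_)).continuousWithinAt
  simp only [Set.mem_sdiff, mem_closedBall, dist_zero_right, mem_ball, not_lt] at hw
  rw [abs_le]; constructor <;> linarith [hw.1, hw.2]

/-- **Change of radius** for `∮ (wa+b)⁻¹ a dw` inside a regular annulus. [folklore] -/
theorem circleIntegral_res_eq_of_annulus {δ : ℝ} (hδ0 : 0 ≤ δ) (hδ : ∀ w : ℂ, |‖w‖ - 1| ≤ δ → IsUnit (pencil a b w)) {r : ℝ}
    (hr₁ : 1 ≤ r) (hr₂ : r ≤ 1 + δ) : (∮ w in C(0, r), res a b w) = ∮ w in C(0, 1), res a b w := by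
  refine circleIntegral_eq_of_differentiable_on_annulus_off_countable zero_lt_one hr₁ countable_empty
    (continuousOn_res_annulus hδ (r₁ := 1) (by linarith) hr₂) fun z hz ↦ ?_
  refine differentiableAt_res a b (hδ z ?_)
  simp only [Set.sdiff_empty, Set.mem_sdiff, mem_ball, dist_zero_right, mem_closedBall, not_le] at hz
  rw [abs_le]; constructor <;> linarith [hz.1, hz.2]

/-! ### `P₀² = P₀` -/

/-- Continuity of `res` on a circle inside the regular annulus. [folklore] -/
theorem continuousOn_res_sphere {δ : ℝ} (hδ : ∀ w : ℂ, |‖w‖ - 1| ≤ δ → IsUnit (pencil a b w)) {r : ℝ}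
    (hr : |r - 1| ≤ δ) : ContinuousOn (res a b) (sphere 0 r) := fun w hw ↦
  (continuousAt_res a b (hδ w (by rw [mem_sphere_zero_iff_norm.1 hw]; exact hr))).continuousWithinAt

/-- Auxiliary statement for spectral projections of a regular pencil. [folklore] -/
theorem circleIntegrable_res_of_annulus {δ : ℝ} (hδ : ∀ w : ℂ, |‖w‖ - 1| ≤ δ → IsUnit (pencil a b w)) {r : ℝ}
    (hr : |r - 1| ≤ δ) (hr0 : 0 ≤ r) : CircleIntegrable (res a b) 0 r :=
  (continuousOn_res_sphere hδ hr).circleIntegrable hr0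

/-- The product of the two resolvents on two different circles: `res w · res z = (z - w)⁻¹ (res w - res z)`.
[cite: HusemollerFibreBundles1994, Ch. 11 §4 (R)] -/
theorem res_mul_res {w z : ℂ} (hw : IsUnit (pencil a b w)) (hz : IsUnit (pencil a b z)) (hne : z ≠ w) :
    res a b w * res a b z = (z - w)⁻¹ • (res a b w - res a b z) := by
  have h := inverse_sub_inverse a b hw hz
  have hsub : z - w ≠ 0 := sub_ne_zero.2 hne
  have h2 : res a b w * Ring.inverse (pencil a b z) = (z - w)⁻¹ • (Ring.inverse (pencil a b w) - Ring.inverse (pencil a b z)) := by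
    rw [h, smul_smul, inv_mul_cancel₀ hsub, one_smul]
  calc res a b w * res a b z = res a b w * Ring.inverse (pencil a b z) * a := by simp only [res, Matrix.mul_assoc]
    _ = (z - w)⁻¹ • (res a b w - res a b z) := by rw [h2, Matrix.smul_mul, Matrix.sub_mul]; rfl

/-- `∮_{|w| = r} (z - w)⁻¹ dw = -2πi` for `|z| < r`. [folklore] -/
theorem circleIntegral_inv_sub_of_mem_ball {z : ℂ} {r : ℝ} (hz : z ∈ ball (0 : ℂ) r) :
    (∮ w in C(0, r), (z - w)⁻¹) = -(2 * π * I) := by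
  have h : (fun w : ℂ ↦ (z - w)⁻¹) = fun w ↦ (-1 : ℂ) • (w - z)⁻¹ := by
    ext w; rw [← neg_sub, inv_neg]; simp
  rw [h, circleIntegral.integral_smul, circleIntegral.integral_sub_inv_of_mem_ball hz]; simp

/-- **`P₀² = P₀`** (Husemöller, Ch. 11 Prop. 4.2, via the resolvent identity (R), two radii and
Fubini). [cite: HusemollerFibreBundles1994, Ch. 11 Prop. 4.2] -/
theorem IsRegular.P0_mul_P0 (h : IsRegular a b) : P0 a b * P0 a b = P0 a b := by
  obtain ⟨δ, hδ0, hδ1, hδ⟩ := h.exists_annulus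
  set r : ℝ := 1 + δ with hr
  have hr1 : |r - 1| ≤ δ := by rw [hr, add_sub_cancel_left, abs_of_pos hδ0]
  have h11 : |(1 : ℝ) - 1| ≤ δ := by rw [sub_self, abs_zero]; exact hδ0.le
  have hr0 : (0 : ℝ) ≤ r := by linarith
  set J₁ := ∮ z in C(0, 1), res a b z with hJ₁
  have hJr : (∮ w in C(0, r), res a b w) = J₁ := circleIntegral_res_eq_of_annulus hδ0.le hδ (by linarith) le_rfl
  have hir : CircleIntegrable (res a b) 0 r := circleIntegrable_res_of_annulus hδ hr1 hr0
  have hi1 : CircleIntegrable (res a b) 0 1 := circleIntegrable_res_of_annulus hδ h11 zero_le_one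
  -- units on the two circles
  have hu_r : ∀ w ∈ sphere (0 : ℂ) r, IsUnit (pencil a b w) := fun w hw ↦
    hδ w (by rw [mem_sphere_zero_iff_norm.1 hw]; exact hr1)
  have hu_1 : ∀ z ∈ sphere (0 : ℂ) 1, IsUnit (pencil a b z) := fun z hz ↦
    hδ z (by rw [mem_sphere_zero_iff_norm.1 hz]; exact h11)
  have hne : ∀ w ∈ sphere (0 : ℂ) r, ∀ z ∈ sphere (0 : ℂ) 1, z ≠ w := by
    intro w hw z hz heq
    rw [mem_sphere_zero_iff_norm] at hw hz
    rw [heq, hw, hr] at hz; linarith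
  -- Step 1: `J_r J₁ = ∮_w ∮_z res w res z`
  have step1 : (∮ w in C(0, r), res a b w) * J₁ = ∮ w in C(0, r), ∮ z in C(0, 1), (z - w)⁻¹ • (res a b w - res a b z) := by
    rw [← circleIntegral_mul_const J₁ hir]
    refine circleIntegral.integral_congr hr0 fun w hw ↦ ?_
    simp only [hJ₁]
    rw [← circleIntegral_const_mul (res a b w) hi1]
    refine circleIntegral.integral_congr zero_le_one fun z hz ↦ ?_
    exact res_mul_res (hu_r w hw) (hu_1 z hz) (hne w hw z hz)
  -- Step 2: inner integral = `-(∮_z (z - w)⁻¹ • res z)` for `|w| = r`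
  have step2 : ∀ w ∈ sphere (0 : ℂ) r, (∮ z in C(0, 1), (z - w)⁻¹ • (res a b w - res a b z)) =
      -∮ z in C(0, 1), (z - w)⁻¹ • res a b z := by
    intro w hw
    have hw' : 1 < ‖w‖ := by rw [mem_sphere_zero_iff_norm.1 hw, hr]; linarith
    have hcont_inv : ContinuousOn (fun z : ℂ ↦ (z - w)⁻¹) (sphere 0 1) :=
      ContinuousOn.inv₀ (continuousOn_id.sub continuousOn_const) fun z hz ↦ sub_ne_zero.2 (hne w hw z hz)
    have hiA : CircleIntegrable (fun z : ℂ ↦ (z - w)⁻¹ • res a b w) 0 1 :=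
      (hcont_inv.smul continuousOn_const).circleIntegrable zero_le_one
    have hiB : CircleIntegrable (fun z : ℂ ↦ (z - w)⁻¹ • res a b z) 0 1 :=
      (hcont_inv.smul (continuousOn_res_sphere hδ h11)).circleIntegrable zero_le_one
    simp_rw [smul_sub]
    rw [circleIntegral.integral_sub hiA hiB, circleIntegral.integral_smul_const, circleIntegral_sub_inv_of_one_lt hw',
      zero_smul, zero_sub]
  -- Step 3: Fubini and the inner `w`-integral
  have step3 : (∮ w in C(0, r), ∮ z in C(0, 1), (z - w)⁻¹ • res a b z) = (-(2 * π * I)) • J₁ := by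
    have hcont : ContinuousOn (Function.uncurry fun w z : ℂ ↦ (z - w)⁻¹ • res a b z) (sphere 0 |r| ×ˢ sphere 0 |1|) := by
      rw [abs_of_nonneg hr0, abs_one]
      have hA : ContinuousOn (fun p : ℂ × ℂ ↦ (p.2 - p.1)⁻¹) (sphere 0 r ×ˢ sphere 0 1) :=
        (continuous_snd.sub continuous_fst).continuousOn.inv₀ fun p hp ↦ sub_ne_zero.2 (hne p.1 hp.1 p.2 hp.2)
      have hB : ContinuousOn (fun p : ℂ × ℂ ↦ res a b p.2) (sphere 0 r ×ˢ sphere 0 1) :=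
        (continuousOn_res_sphere hδ h11).comp continuous_snd.continuousOn fun p hp ↦ hp.2
      exact hA.smul hB
    rw [circleIntegral_swap hcont]
    have hinner : ∀ z ∈ sphere (0 : ℂ) 1, (∮ w in C(0, r), (z - w)⁻¹ • res a b z) = (-(2 * π * I)) • res a b z := by
      intro z hz
      have hzr : z ∈ ball (0 : ℂ) r := by
        rw [mem_ball, dist_zero_right, mem_sphere_zero_iff_norm.1 hz, hr]; linarith
      rw [circleIntegral.integral_smul_const, circleIntegral_inv_sub_of_mem_ball hzr]
    rw [circleIntegral.integral_congr zero_le_one hinner, circleIntegral.integral_smul]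
  -- assembly
  have hc : (2 * π * I : ℂ)⁻¹ * (2 * π * I) = 1 := inv_mul_cancel₀ (by simp [Real.pi_ne_zero, I_ne_zero])
  have step2' : (∮ w in C(0, r), ∮ z in C(0, 1), (z - w)⁻¹ • (res a b w - res a b z)) =
      (-1 : ℂ) • ∮ w in C(0, r), ∮ z in C(0, 1), (z - w)⁻¹ • res a b z := by
    rw [← circleIntegral.integral_smul]
    refine circleIntegral.integral_congr hr0 fun w hw ↦ ?_
    rw [step2 w hw, neg_one_smul]
  calc P0 a b * P0 a b = ((2 * π * I)⁻¹ • ∮ w in C(0, r), res a b w) * ((2 * π * I)⁻¹ • J₁) := by rw [hJr]; rfl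
    _ = ((2 * π * I)⁻¹ * (2 * π * I)⁻¹) • ((∮ w in C(0, r), res a b w) * J₁) := by
        rw [Matrix.smul_mul, Matrix.mul_smul, smul_smul]
    _ = ((2 * π * I)⁻¹ * (2 * π * I)⁻¹) • ((-1 : ℂ) • ((-(2 * π * I)) • J₁)) := by rw [step1, step2', step3]
    _ = P0 a b := by
        rw [smul_smul, smul_smul, P0]
        congr 1
        linear_combination (2 * π * I : ℂ)⁻¹ * hc

/-! ### `P_∞` and the invertibility of the homotopy `p^t` (Husemöller 4.5–4.6) -/

/-- `P_∞ = (a + b) P₀ (a + b)⁻¹` is idempotent. [cite: HusemollerFibreBundles1994, Ch. 11 Prop. 4.2] -/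
theorem IsRegular.Pinf_mul_Pinf (h : IsRegular a b) : Pinf a b * Pinf a b = Pinf a b := by
  obtain ⟨U, hU⟩ := h 1 (by simp)
  have h1 := h.pencil_mul_P0 1
  rw [← hU] at h1
  -- `Pinf = U P0 U⁻¹`
  have hQ : Pinf a b = (U : Matrix ι ι ℂ) * P0 a b * ((U⁻¹ : (Matrix ι ι ℂ)ˣ) : Matrix ι ι ℂ) := by
    rw [h1, Matrix.mul_assoc, Units.mul_inv, Matrix.mul_one]
  rw [hQ]
  calc (U : Matrix ι ι ℂ) * P0 a b * ((U⁻¹ : (Matrix ι ι ℂ)ˣ) : Matrix ι ι ℂ) * (↑U * P0 a b * ((U⁻¹ : (Matrix ι ι ℂ)ˣ) : Matrix ι ι ℂ))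
      = ↑U * (P0 a b * (((U⁻¹ : (Matrix ι ι ℂ)ˣ) : Matrix ι ι ℂ) * ↑U) * P0 a b) * ((U⁻¹ : (Matrix ι ι ℂ)ˣ) : Matrix ι ι ℂ) := by
        simp only [Matrix.mul_assoc]
    _ = ↑U * P0 a b * ((U⁻¹ : (Matrix ι ι ℂ)ˣ) : Matrix ι ι ℂ) := by rw [Units.inv_mul, Matrix.mul_one, h.P0_mul_P0]

/-- Linear combinations of `a`, `b` intertwine `P₀` and `P_∞`. [cite: HusemollerFibreBundles1994, Ch. 11 Prop. 4.2] -/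
theorem IsRegular.comb_mul_P0 (h : IsRegular a b) (c d : ℂ) : (c • a + d • b) * P0 a b = Pinf a b * (c • a + d • b) := by
  rw [Matrix.add_mul, Matrix.mul_add, Matrix.smul_mul, Matrix.smul_mul, Matrix.mul_smul, Matrix.mul_smul, h.a_mul_P0, h.b_mul_P0]

/-- Vectors in `im P₀` killed by `z a + t b` (`|z| = 1`, `0 ≤ t ≤ 1`) vanish. [cite: HusemollerFibreBundles1994, Ch. 11 Prop. 4.5] -/
theorem IsRegular.eq_zero_of_plus (h : IsRegular a b) {t : ℝ} (ht0 : 0 ≤ t) (ht1 : t ≤ 1) {z : ℂ} (hz : ‖z‖ = 1)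
    {u : ι → ℂ} (hPu : P0 a b *ᵥ u = u) (hu : (z • a + (t : ℂ) • b) *ᵥ u = 0) : u = 0 := by
  have hz0 : z ≠ 0 := by rintro rfl; simp at hz
  rcases ht0.eq_or_lt with rfl | ht0'
  · -- `t = 0`: `a u = 0`
    have hau : a *ᵥ u = 0 := by
      have : z • (a *ᵥ u) = 0 := by simpa [Matrix.add_mulVec, Matrix.smul_mulVec] using hu
      exact (smul_eq_zero.1 this).resolve_left hz0
    rw [← hPu, h.P0_mulVec_eq_zero_of_a hau]
  · have hpen : pencil a b (z / t) *ᵥ u = 0 := by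
      have : pencil a b (z / t) = ((t : ℂ)⁻¹) • (z • a + (t : ℂ) • b) := by
        rw [pencil, smul_add, smul_smul, smul_smul, inv_mul_cancel₀ (by exact_mod_cast ht0'.ne'), one_smul, div_eq_inv_mul]
      rw [this, Matrix.smul_mulVec, hu, smul_zero]
    rcases ht1.eq_or_lt with rfl | ht1'
    · obtain ⟨W, hW⟩ := h (z / (1 : ℝ)) (by simp [hz])
      have := congrArg (fun x ↦ (↑W⁻¹ : Matrix ι ι ℂ) *ᵥ x) hpen
      simpa only [← hW, Matrix.mulVec_mulVec, Units.inv_mul, Matrix.one_mulVec, Matrix.mulVec_zero] using this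
    · have hgt : 1 < ‖z / (t : ℂ)‖ := by
        rw [norm_div, hz, Complex.norm_real, Real.norm_eq_abs, abs_of_pos ht0', one_div]
        exact one_lt_inv_iff₀.2 ⟨ht0', ht1'⟩
      rw [← hPu, h.P0_mulVec_eq_zero_of_gt hpen hgt]

/-- Vectors in `ker P₀` killed by `t z a + b` (`|z| = 1`, `0 ≤ t ≤ 1`) vanish. [cite: HusemollerFibreBundles1994, Ch. 11 Prop. 4.5] -/
theorem IsRegular.eq_zero_of_minus (h : IsRegular a b) {t : ℝ} (ht0 : 0 ≤ t) (ht1 : t ≤ 1) {z : ℂ} (hz : ‖z‖ = 1)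
    {u : ι → ℂ} (hPu : P0 a b *ᵥ u = 0) (hu : (((t : ℂ) * z) • a + b) *ᵥ u = 0) : u = 0 := by
  have hpen : pencil a b ((t : ℂ) * z) *ᵥ u = 0 := hu
  rcases ht1.eq_or_lt with rfl | ht1'
  · obtain ⟨W, hW⟩ := h (((1 : ℝ) : ℂ) * z) (by simp [hz])
    have := congrArg (fun x ↦ (↑W⁻¹ : Matrix ι ι ℂ) *ᵥ x) hpen
    simpa only [← hW, Matrix.mulVec_mulVec, Units.inv_mul, Matrix.one_mulVec, Matrix.mulVec_zero] using this
  · have hlt : ‖(t : ℂ) * z‖ < 1 := by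
      rw [norm_mul, hz, mul_one, Complex.norm_real, Real.norm_eq_abs, abs_of_nonneg ht0]; exact ht1'
    have := h.P0_mulVec_eq_self_of_lt hpen hlt
    rw [hPu] at this
    exact this.symm

/-- **The homotopy `p^t = (za + tb) P₀ + (tza + b)(1 - P₀)` consists of invertible matrices**
(`|z| = 1`, `0 ≤ t ≤ 1`; Husemöller, Ch. 11 Props. 4.5, 4.6). [cite: HusemollerFibreBundles1994, Ch. 11 Prop. 4.6] -/
theorem IsRegular.isUnit_homotopy (h : IsRegular a b) {t : ℝ} (ht0 : 0 ≤ t) (ht1 : t ≤ 1) {z : ℂ} (hz : ‖z‖ = 1) :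
    IsUnit ((z • a + (t : ℂ) • b) * P0 a b + (((t : ℂ) * z) • a + b) * (1 - P0 a b)) := by
  set P := P0 a b
  set Q := Pinf a b
  have hP : P * P = P := h.P0_mul_P0
  have hQ : Q * Q = Q := h.Pinf_mul_Pinf
  have hX : (z • a + (t : ℂ) • b) * P = Q * (z • a + (t : ℂ) • b) := h.comb_mul_P0 z t
  have hY : (((t : ℂ) * z) • a + b) * P = Q * (((t : ℂ) * z) • a + b) := by
    simpa using h.comb_mul_P0 ((t : ℂ) * z) 1
  rw [← Matrix.mulVec_injective_iff_isUnit]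
  intro v₁ v₂ hv
  rw [← sub_eq_zero]
  set v := v₁ - v₂ with hvdef
  have hMv : ((z • a + (t : ℂ) • b) * P + (((t : ℂ) * z) • a + b) * (1 - P)) *ᵥ v = 0 := by
    rw [hvdef, Matrix.mulVec_sub, sub_eq_zero]; exact hv
  -- the two components
  set X := ((z • a + (t : ℂ) • b) * P) *ᵥ v
  set Y := ((((t : ℂ) * z) • a + b) * (1 - P)) *ᵥ v
  have hXY : X + Y = 0 := by rw [← Matrix.add_mulVec]; exact hMv
  have hQX : Q *ᵥ X = X := by
    simp only [X]; rw [Matrix.mulVec_mulVec, ← Matrix.mul_assoc, ← hX, Matrix.mul_assoc, hP]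
  have hQY : Q *ᵥ Y = 0 := by
    have e : Q * ((((t : ℂ) * z) • a + b) * (1 - P)) = 0 := by
      rw [Matrix.mul_sub, Matrix.mul_one, hY, Matrix.mul_sub, ← Matrix.mul_assoc, hQ, sub_self]
    simp only [Y]
    rw [Matrix.mulVec_mulVec, e, Matrix.zero_mulVec]
  have hX0 : X = 0 := by
    have := congrArg (fun w ↦ Q *ᵥ w) hXY
    simpa only [Matrix.mulVec_add, hQX, hQY, add_zero, Matrix.mulVec_zero] using this
  have hY0 : Y = 0 := by rwa [hX0, zero_add] at hXY
  -- `u = P v` and `u' = (1 - P) v` vanish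
  have hu : P *ᵥ v = 0 := by
    refine h.eq_zero_of_plus ht0 ht1 hz (u := P *ᵥ v) (by rw [Matrix.mulVec_mulVec, hP]) ?_
    rw [Matrix.mulVec_mulVec]; exact hX0
  have hu' : (1 - P) *ᵥ v = 0 := by
    refine h.eq_zero_of_minus ht0 ht1 hz (u := (1 - P) *ᵥ v) ?_ ?_
    · rw [Matrix.mulVec_mulVec, Matrix.mul_sub, Matrix.mul_one, hP, sub_self, Matrix.zero_mulVec]
    · rw [Matrix.mulVec_mulVec]; exact hY0

  have : v = P *ᵥ v + (1 - P) *ᵥ v := by rw [Matrix.sub_mulVec, Matrix.one_mulVec, add_sub_cancel]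
  rw [this, hu, hu', add_zero]

/-! ### Continuity of `P₀` in continuous regular families -/

/-- `Ring.inverse` of a continuous family of invertible matrices is continuous. [folklore] -/
theorem continuous_inverse_family {Y : Type*} [TopologicalSpace Y] {g : Y → Matrix ι ι ℂ} (hg : Continuous g)
    (hu : ∀ y, IsUnit (g y)) : Continuous fun y ↦ Ring.inverse (g y) := by
  rw [continuous_iff_continuousAt]
  intro y
  obtain ⟨u, hu'⟩ := hu y
  have h1 : ContinuousAt Ring.inverse (g y) := hu' ▸ NormedRing.inverse_continuousAt u
  exact h1.comp hg.continuousAt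

/-- **`P₀` depends continuously on the (regular) pencil.** [cite: HusemollerFibreBundles1994, Ch. 11 Prop. 4.3] -/
theorem continuous_P0_family {Y : Type*} [TopologicalSpace Y] {A B : Y → Matrix ι ι ℂ} (hA : Continuous A) (hB : Continuous B)
    (hreg : ∀ y, IsRegular (A y) (B y)) : Continuous fun y ↦ P0 (A y) (B y) := by
  simp only [P0, circleIntegral]
  refine (continuous_const (y := (2 * π * I : ℂ)⁻¹)).smul ?_
  have hpen : Continuous fun p : Y × ℝ ↦ pencil (A p.1) (B p.1) (circleMap 0 1 p.2) := by
    simp only [pencil]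
    exact (((continuous_circleMap 0 1).comp continuous_snd).smul (hA.comp continuous_fst)).add (hB.comp continuous_fst)
  have hinv : Continuous fun p : Y × ℝ ↦ Ring.inverse (pencil (A p.1) (B p.1) (circleMap 0 1 p.2)) :=
    continuous_inverse_family hpen fun p ↦ hreg p.1 _ (by simp)
  have hF : Continuous (Function.uncurry fun (y : Y) (θ : ℝ) ↦ deriv (circleMap 0 1) θ • res (A y) (B y) (circleMap 0 1 θ)) := by
    simp only [res, deriv_circleMap]
    exact (((continuous_circleMap 0 1).comp continuous_snd).mul continuous_const).smul (hinv.mul (hA.comp continuous_fst))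
  exact intervalIntegral.continuous_parametric_intervalIntegral_of_continuous hF continuous_const

/-- `P₀` is natural: it only depends on the pencil (trivial, recorded for base change). [folklore] -/
theorem P0_congr {a a' b b' : Matrix ι ι ℂ} (ha : a = a') (hb : b = b') : P0 a b = P0 a' b' := by subst ha hb; rfl

end Literature.AlgebraicTopology.KTheory.Pencil

end
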